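import Summits.HubbardSuperconductivity.HubbardSuperconductivity.Theses.KkFloor
import Summits.HubbardSuperconductivity.HubbardSuperconductivity.Theorems.TwTipContinuation.Negative.TipNormalForm
import Summits.HubbardSuperconductivity.HubbardSuperconductivity.Theorems.BalabanIRBirGroundStateAverageLROStubSectorProjCommutePair
import Literature.MathematicalPhysics.QuantumLattice.FinDimSpectrumSectorGibbsLimit

/-!
# Route `KkFloor` — glue item `KkLiftToSummit` (stmt-HubbardSuperconductivity-10410)

`KkLiftToSummit : KkFloorTheorem → KkBandLift → HubbardSuperconductivity` is the route's
bookkeeping glue: at the witness `(U, δ)` of `KkBandLift` and every even side `L ≥ L₀`,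
instantiate the Kramers–Kronig floor `KkFloorTheorem` with

* `n :=` the Fock basis of the `L × L` torus, `A := H_L = hubbardTorus 2 L 1 U` (Hermitian),
  `B := Π_L = (1/L²) • Δ_dᴴ Δ_d` (Hermitian with nonnegative form), `V := szSector N_L 0`
  (`N_L = 2⌊(1-δ)L²/2⌋`; invariant under `H_L` and `Δ_dᴴ Δ_d`, both conserve `(N↑, N↓)`),
* `E := E₀(L) = minEnergyOn H_L V` (below every unit Rayleigh quotient on `V`,
  `minEnergyOn_le_rayleigh_of_mem`), `ψ :=` any normalised sector ground state (an eigenvector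
  with eigenvalue `E₀(L)` by `IsGroundStateInSector`),
* `S := [Y₁, Y₂]`, profile `d ≡ ε L²` (the band hypothesis is literally the eigenvalue clause);

the floor gives `∫⁻_{[Y₁,Y₂]} ε L² / y² ≤ π · re ⟨ψ, Π_L ψ⟩ = (π / L²) re ⟨ψ, Δ_dᴴ Δ_d ψ⟩`, and
`∫⁻_{[Y₁,Y₂]} ε L² / y² ≥ ε L² (Y₂ - Y₁) / Y₂²` (pointwise `1/y² ≥ 1/Y₂²` on the band, Lebesgue
measure of the band `Y₂ - Y₁`), whence the uniform every-ground-state floor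
`re ⟨ψ, Δ_dᴴ Δ_d ψ⟩ ≥ c L⁴`, `c = ε (Y₂ - Y₁) / (π Y₂²) > 0`. The summit at `(U, δ)` then follows
from the tree's even-side `liminf` bookkeeping `summitMatrix_of_everyGSOrder`
(`Theorems/TwTipContinuation/Negative/TipNormalForm.lean`).

Sources: D. J. Scalapino, Phys. Rep. 250 (1995) 329, §2 (order parameter); the floor itself is
the route's item `KkFloorTheorem`, carried as a hypothesis. No new definitions.
-/

-- the mandated namespace `Summit.<Summit>.<Problem>.Theorems` repeats `HubbardSuperconductivity`
-- (single-problem summit, D-0017), which the `dupNamespace` linter flags on every declaration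
set_option linter.dupNamespace false

namespace Summit.HubbardSuperconductivity.HubbardSuperconductivity.Theorems

open Matrix MeasureTheory
open Literature.MathematicalPhysics.QuantumLattice Literature.Probability.LatticeModels
open Summit.HubbardSuperconductivity.TwTipContinuation.Negative
  (summitMatrix_of_everyGSOrder expect_pairIntensity_nonneg)
open scoped ComplexOrder

/-- The floor step at one side: from the Kramers–Kronig floor theorem (hypothesis `hFloor`, the
route item `KkFloorTheorem` verbatim) and the band lift at side `L` (every sector eigenvalue of
`H_L + i y Π_L`, `y ∈ [Y₁, Y₂]`, has real part `≥ E₀(L) + ε L²`), every normalised sector ground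
state `ψ` has `ε (Y₂ - Y₁) / (π Y₂²) · L⁴ ≤ re ⟨ψ, Δ_dᴴ Δ_d ψ⟩`. [folklore] -/
theorem kkFloor_everyGS_floor
    (hFloor : Summit.HubbardSuperconductivity.HubbardSuperconductivity.Theses.KkFloor.KkFloorTheorem)
    (L : ℕ) [NeZero L] (U : ℝ) (N2 : ℕ) {ε Y₁ Y₂ : ℝ} (hε : 0 < ε) (hY₁ : 0 < Y₁) (hY₁₂ : Y₁ < Y₂)
    (hband : ∀ y ∈ Set.Icc Y₁ Y₂, ∀ φ : Fock (Orb (FermionTorus 2 L)),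
      φ ∈ szSector (Λ := FermionTorus 2 L) (2 * N2) 0 → φ ≠ 0 → ∀ lam : ℂ,
        (hubbardTorus 2 L 1 U + (Complex.I * (y : ℂ)) • ((((1 : ℝ) / (L : ℝ) ^ 2 : ℝ) : ℂ) •
          ((pairField dWaveFormFactor L)ᴴ * pairField dWaveFormFactor L))) *ᵥ φ = lam • φ →
        (hubbardTorus 2 L 1 U).minEnergyOn (szSector (Λ := FermionTorus 2 L) (2 * N2) 0) +
          ε * (L : ℝ) ^ 2 ≤ lam.re)
    {ψ : Fock (Orb (FermionTorus 2 L))} (hψ1 : star ψ ⬝ᵥ ψ = 1)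
    (hψ : IsGroundStateInSector (hubbardTorus 2 L 1 U) (2 * N2) 0 ψ) :
    ε * (Y₂ - Y₁) / (Real.pi * Y₂ ^ 2) * (L : ℝ) ^ 4 ≤
      (expect ((pairField dWaveFormFactor L)ᴴ * pairField dWaveFormFactor L) ψ).re := by
  -- notation
  set H : Matrix (Finset (Orb (FermionTorus 2 L))) (Finset (Orb (FermionTorus 2 L))) ℂ :=
    hubbardTorus 2 L 1 U with hH
  set P : Matrix (Finset (Orb (FermionTorus 2 L))) (Finset (Orb (FermionTorus 2 L))) ℂ :=
    (pairField dWaveFormFactor L)ᴴ * pairField dWaveFormFactor L with hP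
  set B : Matrix (Finset (Orb (FermionTorus 2 L))) (Finset (Orb (FermionTorus 2 L))) ℂ :=
    ((((1 : ℝ) / (L : ℝ) ^ 2 : ℝ) : ℂ)) • P with hB
  set V : Submodule ℂ (Fock (Orb (FermionTorus 2 L))) :=
    szSector (Λ := FermionTorus 2 L) (2 * N2) 0 with hV
  set E : ℝ := H.minEnergyOn V with hE
  have hL : (0 : ℝ) < (L : ℝ) := Nat.cast_pos.2 (Nat.pos_of_ne_zero (NeZero.ne L))
  have hL2 : (0 : ℝ) < (L : ℝ) ^ 2 := by positivity
  -- hypotheses of the floor theorem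
  have hHh : H.IsHermitian := hubbardTorus_isHermitian (hamiltonian_isHermitian_and_commute_holds _) 1 U
  have hPpsd : P.PosSemidef := pairField_conjTranspose_mul_self_posSemidef dWaveFormFactor L
  have hBh : B.IsHermitian :=
    hPpsd.isHermitian.smul (by rw [isSelfAdjoint_iff, Complex.star_def, Complex.conj_ofReal])
  have hPre : ∀ v : Fock (Orb (FermionTorus 2 L)), 0 ≤ (star v ⬝ᵥ P *ᵥ v).re := fun v =>
    expect_pairIntensity_nonneg L v
  have hBre : ∀ v : Fock (Orb (FermionTorus 2 L)),
      (star v ⬝ᵥ B *ᵥ v).re = (1 : ℝ) / (L : ℝ) ^ 2 * (star v ⬝ᵥ P *ᵥ v).re := by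
    intro v
    rw [hB, smul_mulVec, dotProduct_smul, smul_eq_mul, Complex.re_ofReal_mul]
  have hBnonneg : ∀ v : Fock (Orb (FermionTorus 2 L)), 0 ≤ (star v ⬝ᵥ B *ᵥ v).re := by
    intro v
    rw [hBre]
    exact mul_nonneg (by positivity) (hPre v)
  have hHinv : ∀ v ∈ V, H *ᵥ v ∈ V := fun v hv => hubbardTorus_mulVec_mem_szSector 2 L 1 U N2 hv
  have hBinv : ∀ v ∈ V, B *ᵥ v ∈ V := by
    intro v hv
    rw [hB, smul_mulVec]
    exact V.smul_mem _ (BirGroundStateAverageLRO.Softmin.pairPenalty_mulVec_mem_szSector L N2 hv)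
  have hEle : ∀ v ∈ V, star v ⬝ᵥ v = 1 → E ≤ (star v ⬝ᵥ H *ᵥ v).re := fun v hv hv1 =>
    minEnergyOn_le_rayleigh_of_mem hHh V hv hv1
  have hEig : ∀ y ∈ Set.Icc Y₁ Y₂, ∀ v ∈ V, v ≠ 0 → ∀ lam : ℂ,
      (H + (Complex.I * (y : ℂ)) • B) *ᵥ v = lam • v → E + (fun _ : ℝ => ε * (L : ℝ) ^ 2) y ≤ lam.re :=
    fun y hy v hv hv0 lam hlam => hband y hy v hv hv0 lam hlam
  -- the floor
  have key := hFloor (Finset (Orb (FermionTorus 2 L))) H B V E (Set.Icc Y₁ Y₂)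
    (fun _ => ε * (L : ℝ) ^ 2) ψ hHh hBh hBnonneg hHinv hBinv hEle hψ.1 hψ1 hψ.2.2 hEig
  -- lower bound of the lower Lebesgue integral on the band
  have hY₂ : 0 < Y₂ := hY₁.trans hY₁₂
  have hconst : ∀ y ∈ Set.Icc Y₁ Y₂,
      ENNReal.ofReal (ε * (L : ℝ) ^ 2 / Y₂ ^ 2) ≤ ENNReal.ofReal (ε * (L : ℝ) ^ 2 / y ^ 2) := by
    intro y hy
    have hy0 : 0 < y := hY₁.trans_le hy.1
    refine ENNReal.ofReal_le_ofReal (div_le_div_of_nonneg_left (by positivity) (by positivity) ?_)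
    exact pow_le_pow_left₀ hy0.le hy.2 2
  have hlow : ENNReal.ofReal (ε * (L : ℝ) ^ 2 / Y₂ ^ 2 * (Y₂ - Y₁)) ≤
      ∫⁻ y in Set.Icc Y₁ Y₂, ENNReal.ofReal ((fun _ : ℝ => ε * (L : ℝ) ^ 2) y / y ^ 2) := by
    calc ENNReal.ofReal (ε * (L : ℝ) ^ 2 / Y₂ ^ 2 * (Y₂ - Y₁))
        = ENNReal.ofReal (ε * (L : ℝ) ^ 2 / Y₂ ^ 2) * volume (Set.Icc Y₁ Y₂) := by
          rw [Real.volume_Icc, ENNReal.ofReal_mul (by positivity)]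
      _ = ∫⁻ _ in Set.Icc Y₁ Y₂, ENNReal.ofReal (ε * (L : ℝ) ^ 2 / Y₂ ^ 2) := by
          rw [setLIntegral_const]
      _ ≤ ∫⁻ y in Set.Icc Y₁ Y₂, ENNReal.ofReal ((fun _ : ℝ => ε * (L : ℝ) ^ 2) y / y ^ 2) :=
          setLIntegral_mono' measurableSet_Icc fun y hy => hconst y hy
  have hfin := hlow.trans key
  have hrhs : 0 ≤ Real.pi * (star ψ ⬝ᵥ B *ᵥ ψ).re := mul_nonneg Real.pi_pos.le (hBnonneg ψ)
  rw [ENNReal.ofReal_le_ofReal_iff hrhs, hBre] at hfin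
  -- hfin : ε L² / Y₂² · (Y₂ - Y₁) ≤ π · ((1/L²) · re⟨ψ, P ψ⟩)
  have hexp : (expect P ψ).re = (star ψ ⬝ᵥ P *ᵥ ψ).re := rfl
  rw [hexp]
  have hπ : 0 < Real.pi := Real.pi_pos
  -- goal: ε (Y₂ - Y₁) / (π Y₂²) · L⁴ ≤ re⟨ψ,Pψ⟩; multiply `hfin` by L²/π
  have h1 : ε * (L : ℝ) ^ 2 / Y₂ ^ 2 * (Y₂ - Y₁) * ((L : ℝ) ^ 2 / Real.pi) ≤
      Real.pi * ((1 : ℝ) / (L : ℝ) ^ 2 * (star ψ ⬝ᵥ P *ᵥ ψ).re) * ((L : ℝ) ^ 2 / Real.pi) :=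
    mul_le_mul_of_nonneg_right hfin (by positivity)
  have h2 : ε * (L : ℝ) ^ 2 / Y₂ ^ 2 * (Y₂ - Y₁) * ((L : ℝ) ^ 2 / Real.pi) =
      ε * (Y₂ - Y₁) / (Real.pi * Y₂ ^ 2) * (L : ℝ) ^ 4 := by
    field_simp
  have h3 : Real.pi * ((1 : ℝ) / (L : ℝ) ^ 2 * (star ψ ⬝ᵥ P *ᵥ ψ).re) * ((L : ℝ) ^ 2 / Real.pi) =
      (star ψ ⬝ᵥ P *ᵥ ψ).re := by
    field_simp
  rw [h2, h3] at h1
  exact h1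

/-- **KkLiftToSummit** (item `stmt-HubbardSuperconductivity-10410`):
`KkFloorTheorem → KkBandLift → HubbardSuperconductivity`. At the witness `(U, δ)` of the band
lift, `kkFloor_everyGS_floor` gives the uniform every-ground-state floor
`c L⁴ ≤ re ⟨ψ, Δ_dᴴ Δ_d ψ⟩` with `c = ε (Y₂ - Y₁) / (π Y₂²) > 0` at every even `L ≥ L₀`; the
summit's matrix at `(U, δ)` is then the tree's `liminf` bookkeeping
`summitMatrix_of_everyGSOrder`, and `HubbardSuperconductivity` unfolds to
`∃ U > 0, ∃ δ ∈ (0, 1/2), matrix`. Scalapino, Phys. Rep. 250 (1995) 329, §2. [folklore] -/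
theorem kkLiftToSummit_proof :
    Summit.HubbardSuperconductivity.HubbardSuperconductivity.Theses.KkFloor.KkLiftToSummit := by
  unfold Summit.HubbardSuperconductivity.HubbardSuperconductivity.Theses.KkFloor.KkLiftToSummit
  intro hFloor hBand
  obtain ⟨U, hU, δ, hδ, ε, hε, Y₁, hY₁, Y₂, hY₁₂, L₀, hband⟩ := hBand
  have hfloor : ∃ c : ℝ, 0 < c ∧ ∃ L₀ : ℕ, ∀ (L : ℕ) [NeZero L], L₀ ≤ L → Even L →
      ∀ ψ : Fock (Orb (FermionTorus 2 L)), star ψ ⬝ᵥ ψ = 1 →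
        IsGroundStateInSector (hubbardTorus 2 L 1 U) (2 * ⌊(1 - δ) * (L : ℝ) ^ 2 / 2⌋₊) 0 ψ →
          c * (L : ℝ) ^ 4 ≤
            (expect ((pairField dWaveFormFactor L)ᴴ * pairField dWaveFormFactor L) ψ).re := by
    refine ⟨ε * (Y₂ - Y₁) / (Real.pi * Y₂ ^ 2), ?_, L₀, ?_⟩
    · have hY₂ : 0 < Y₂ := hY₁.trans hY₁₂
      exact div_pos (mul_pos hε (sub_pos.2 hY₁₂)) (by positivity)
    · intro L _ hL hEv ψ hψ1 hψ
      exact kkFloor_everyGS_floor hFloor L U _ hε hY₁ hY₁₂ (hband L hL hEv) hψ1 hψ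
  show Literature.Hubbard.DWaveSuperconductivityHubbard
  exact ⟨U, hU, δ, hδ, summitMatrix_of_everyGSOrder hfloor⟩

end Summit.HubbardSuperconductivity.HubbardSuperconductivity.Theorems
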